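import Literature.Computability.QuantumComplexity.TwoLevelUnitary
import Mathlib.Data.Matrix.PEquiv
import HarnessLib

/-!
# Two-level matrices: conjugation by a transposition, block unitarity

Topic `Literature/Computability/QuantumComplexity`; complements `TwoLevelUnitary.lean` (Nielsen–Chuang §4.5.1)
with the facts used by the Gray-code step of the exact-universality proof (`BarencoTwoLevel.lean`):

* `twoLevel_swap_eq` — the two-level matrix with block `X` on `(u, t)` is the permutation matrix of the
  transposition `(u t)`;
* `swap_mul_twoLevel_mul_swap` — conjugating a two-level matrix on `(s, u)` by that transposition moves it to
  `(s, t)` (`s, u, t` distinct);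
* `block_unitary_of_twoLevel_mem_unitaryGroup` — the `2 × 2` block of a unitary two-level matrix is unitary;
  `twoLevel_comm` — exchanging the two labels reverses the block.

All statements are over an arbitrary finite index type. [Nielsen–Chuang 2010, §4.5.1–4.5.2]

## References

* M. A. Nielsen, I. L. Chuang, *Quantum Computation and Quantum Information*, CUP 2010, §4.5.1–4.5.2
  [NielsenChuang2010].
-/

noncomputable section

namespace Literature.Computability.QuantumComplexity

open Matrix Complex

/-! ### More on two-level matrices: transposition conjugation and block unitarity -/

variable {ι : Type*} [Fintype ι] [DecidableEq ι]

omit [Fintype ι] in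
/-- The two-level matrix with block `X` on `(u, t)` is the permutation matrix of the transposition. [folklore] -/
theorem twoLevel_swap_eq (u t : ι) (hut : u ≠ t) :
    twoLevel u t 0 1 1 0 = ((Equiv.swap u t).toPEquiv.toMatrix : Matrix ι ι ℂ) := by
  ext i j
  simp only [PEquiv.toMatrix_apply, Equiv.toPEquiv_apply, Option.mem_def, Option.some.injEq, twoLevel,
    Equiv.swap_apply_def, Matrix.one_apply]
  by_cases hiu : i = u
  · subst hiu
    simp only [if_true, hut]
    by_cases hju : j = i
    · simp [hju, hut.symm]
    · simp [hju, eq_comm]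
  · by_cases hit : i = t
    · subst hit
      simp only [hiu, if_false, if_true]
      by_cases hju : j = u
      · simp [hju]
      · simp [hju, Ne.symm hju]
    · simp [hiu, hit]

/-- **Conjugating a two-level matrix on `(s, u)` by the transposition `(u t)` moves it to `(s, t)`**
(`s, u, t` distinct). [folklore] -/
theorem swap_mul_twoLevel_mul_swap {s u t : ι} (hsu : s ≠ u) (hst : s ≠ t) (hut : u ≠ t) (a b c d : ℂ) :
    twoLevel u t 0 1 1 0 * twoLevel s u a b c d * twoLevel u t 0 1 1 0 = twoLevel s t a b c d := by
  rw [twoLevel_swap_eq u t hut, PEquiv.toMatrix_toPEquiv_mul, PEquiv.mul_toMatrix_toPEquiv, Equiv.symm_swap]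
  ext i j
  simp only [Matrix.submatrix_apply, id]
  have h1 : ∀ k, Equiv.swap u t k = s ↔ k = s := fun k => by
    rw [Equiv.swap_apply_eq_iff, Equiv.swap_apply_of_ne_of_ne hsu hst]
  have h2 : ∀ k, Equiv.swap u t k = u ↔ k = t := fun k => by
    rw [Equiv.swap_apply_eq_iff, Equiv.swap_apply_left]
  simp only [twoLevel, h1, h2, Matrix.one_apply, EmbeddingLike.apply_eq_iff_eq]

omit [Fintype ι] in
/-- Entries of a two-level matrix in its two special rows and columns. [folklore] -/
theorem twoLevel_apply_special {s t : ι} (hst : s ≠ t) (a b c d : ℂ) :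
    twoLevel s t a b c d s s = a ∧ twoLevel s t a b c d s t = b ∧ twoLevel s t a b c d t s = c ∧
      twoLevel s t a b c d t t = d := by
  simp [twoLevel, hst.symm]

/-- The block of a unitary two-level matrix is unitary. [folklore] -/
theorem block_unitary_of_twoLevel_mem_unitaryGroup {s t : ι} (hst : s ≠ t) {a b c d : ℂ}
    (h : twoLevel s t a b c d ∈ Matrix.unitaryGroup ι ℂ) :
    a * star a + b * star b = 1 ∧ a * star c + b * star d = 0 ∧ c * star a + d * star b = 0 ∧
      c * star c + d * star d = 1 := by
  have e := Matrix.mem_unitaryGroup_iff.1 h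
  rw [star_twoLevel a b c d hst, twoLevel_mul_twoLevel hst] at e
  obtain ⟨e1, e2, e3, e4⟩ := twoLevel_apply_special hst (a * star a + b * star b) (a * star c + b * star d)
    (c * star a + d * star b) (c * star c + d * star d)
  rw [e] at e1 e2 e3 e4
  rw [Matrix.one_apply_eq] at e1 e4
  rw [Matrix.one_apply_ne hst] at e2
  rw [Matrix.one_apply_ne hst.symm] at e3
  exact ⟨e1.symm, e2.symm, e3.symm, e4.symm⟩

omit [Fintype ι] in
/-- Swapping the roles of the two coordinates reverses the block. [folklore] -/
theorem twoLevel_comm {s t : ι} (hst : s ≠ t) (a b c d : ℂ) : twoLevel s t a b c d = twoLevel t s d c b a := by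
  ext i j
  simp only [twoLevel]
  by_cases his : i = s <;> by_cases hit : i = t <;> by_cases hjs : j = s <;> by_cases hjt : j = t <;> simp_all

end Literature.Computability.QuantumComplexity
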